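import Summits.CriticalPhenomena.CardyFormulaZ2.Theorems.CardyIKTransportIKLinearTransportGlue
import Summits.CriticalPhenomena.CardyFormulaZ2.Theorems.CardyIKTransportIKLinearTransportPinnedExchangeProved
import Summits.CriticalPhenomena.CardyFormulaZ2.Theorems.CardyIKTransportIKLinearTransportStubTriLawOfEmpty
import Summits.CriticalPhenomena.CardyFormulaZ2.Theorems.CardyIKTransportIKLinearTransportStubCouplingToLimits
import Summits.CriticalPhenomena.CardyFormulaZ2.Theorems.CardyIKTransportIKLinearTransportStubCrudeCardySiteTri
import Summits.CriticalPhenomena.CardyFormulaZ2.Theorems.CardyIKTransportIKLinearTransportTransportGlue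
import Summits.CriticalPhenomena.CardyFormulaZ2.Theorems.CardyIKTransportIKLinearTransportScreeningOffsetMul
import Summits.CriticalPhenomena.CardyFormulaZ2.Theorems.CardyIKTransportIKLinearTransportScreeningMasterMul
import Summits.CriticalPhenomena.CardyFormulaZ2.Theorems.CardyIKTransportIKLinearTransportRatioMix
import Summits.CriticalPhenomena.CardyFormulaZ2.Theorems.CardyIKTransportIKLinearTransportFarRSWOfInputs

/-!
# The crux `CardyIKTransport.IKLinearTransport` (stmt-CriticalPhenomena-5076) FROM ITS TWO REMAINING RESEARCH INPUTS
# (line `pinned-diagram-exchange`, skeleton v14 made importable; lead seat c3)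

Theorem-only support file (`--supports stmt-CriticalPhenomena-5076`, registered sub-goal `IKLinearTransport_of_farInputs`).
The line's reduction skeleton (`Cruxes/IKLinearTransport/Lines/pinned_diagram_exchange.lean`, v14, not importable) has exactly
three `sorry`s left; this file states the same composition with those three statements as HYPOTHESES, so that the reduction is a
kernel-checked theorem of the tree which the eventual closers of the inputs can simply apply:

* input R4 — the route crux r4 `IKMixedBoxCrossing` (stmt-CriticalPhenomena-5911: long-way crossings of `2n × n` boxes,
  uniformly in the column pattern);
* input GLUE — FKG-free gluing: from R4, the UNCONDITIONAL far RSW family at all aspect ratios with black rings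
  (`FarRSWBound c S n a b w h univ`; skeleton stub `stub_FarRSWInputs`);
* input TRANSPORT — the observable-level finite-block transport given exchange kernels, far-conditioned RSW and density-form
  ratio mixing (Manolescu, arXiv:2502.08394 §5.3.2–§5.3.6 re-run without FKG; skeleton stub `stub_WindowTransportFar`, the
  promote candidate).

Everything else is LANDED and used here by name: the exchange kernels `exchangeKernels_IK` / `pinnedExchange_holds` (p129266,
Manolescu Fact 5.15 for IK), density-form ratio mixing `stub_RatioMix` = `ratioMix_of_masterMul screeningOffsetMul screening_master_mul` (p130455, p130428, p130394; by name p131034), "conditioning on far events is free"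
`stub_FarRSWOfInputs` (p130895), the strip law / coupling lift / compositions `stripLaw`, `couplingLift`,
`linearTransport_of_parts_far`, `condRSW_of_farRSW` (p120514, p120993, p121134), `stub_DiagramExchange` (p91210),
`stub_CouplingToLimits` (p91892), `stub_TriLawOfEmpty` (p83265), `stub_CrudeCardySiteTri` (p93655), `crudeCardyTri_of` and the
six-piece composition `IKLinearTransport_of_stubs` (p74749/p92088).
-/

noncomputable section

namespace Summit.CriticalPhenomena.CardyFormulaZ2.Theorems.IKLinearTransport.PinnedDiagramExchange

open scoped BigOperators Topology Classical MeasureTheory ProbabilityTheory ENNReal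
open Filter Set Function MeasureTheory
open Literature.Probability.Percolation Literature.Probability.LatticeModels
open Literature.Probability.RandomPlanarGeometry

/-- **THE CRUX FROM ITS TWO REMAINING RESEARCH INPUTS** (registered sub-goal `IKLinearTransport_of_farInputs`; the line's
skeleton v14 with its three open stubs turned into hypotheses): the route crux r4 `IKMixedBoxCrossing` (stmt-5911), the
FKG-free gluing of its 2:1 crossings into the unconditional far RSW family at all aspect ratios with rings, and Manolescu's
observable-level window transport given kernels + far RSW + ratio mixing, together imply `IKLinearTransport`. Sorry-free;
kernels, ratio mixing, far conditioning, strip law, coupling lift, coupling-to-limits and crude Cardy on `𝕋` are the landed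
theorems of the line. [folklore] -/
theorem IKLinearTransport_of_farInputs :
    Summit.CriticalPhenomena.CardyFormulaZ2.Theses.CardyIKTransport.IKMixedBoxCrossing →
    (Summit.CriticalPhenomena.CardyFormulaZ2.Theses.CardyIKTransport.IKMixedBoxCrossing →
      ∀ k : ℕ, ∃ c : ℝ, 0 < c ∧ ∀ (S : Set ℤ) (n : ℕ), 1 ≤ n → ∀ (a b : ℤ) (w h : ℕ),
        n ≤ w → w ≤ k * n → n ≤ h → h ≤ k * n → FarRSWBound c S n a b w h Set.univ) →
    ((∃ C c : ℝ, 0 < c ∧ ∀ (S : Set ℤ) (i : ℤ), (i ∈ S ↔ i + 1 ∉ S) →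
          ∃ T : Obs → Rnd → Obs, IsExchangeKernel C c S i T) →
      (∀ k : ℕ, ∃ c : ℝ, 0 < c ∧ ∀ (S : Set ℤ) (n : ℕ), 1 ≤ n → ∀ (a b : ℤ) (w h : ℕ),
          n ≤ w → w ≤ k * n → n ≤ h → h ≤ k * n → ∀ E : Set Obs, MeasurableSet E →
          FarRSWBound c S n a b w h E) →
      (∀ (k : ℕ) (η : ℝ), 0 < η → ∃ N : ℕ, ∀ (S : Set ℤ) (n : ℕ), N ≤ n → ∀ (a b : ℤ) (w h : ℕ),
          w ≤ k * n → h ≤ k * n → ∀ E L : Set Obs, MeasurableSet E → MeasurableSet L →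
          RatioMixBound η S n a b w h E L) →
      ∃ K₁ : ℂ ≃L[ℝ] ℂ, ∀ ε ρ A : ℝ, 0 < ε → 0 < ρ → 0 < A →
        ∀ᶠ δ in 𝓝[>] (0 : ℝ), ∃ (S₀ S₁ : Set ℤ) (π : Measure (Obs × Obs)),
          (∀ j : ℤ, |j| ≤ (⌈A / δ⌉₊ : ℤ) → j ∈ S₀ ∧ j ∉ S₁) ∧
          π.map Prod.fst = νmix S₀ ∧ π.map Prod.snd = νmix S₁ ∧
          π (badObs K₁ δ ε ρ) ≤ ENNReal.ofReal ε) →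
    Summit.CriticalPhenomena.CardyFormulaZ2.Theses.CardyIKTransport.IKLinearTransport := by
  intro hR4 hGlue hTransport
  -- density-form ratio mixing at all aspect ratios (landed sub-goals of `stub_RatioMix`)
  have hMix : ∀ (k : ℕ) (η : ℝ), 0 < η → ∃ N : ℕ, ∀ (S : Set ℤ) (n : ℕ), N ≤ n → ∀ (a b : ℤ) (w h : ℕ),
      w ≤ k * n → h ≤ k * n → ∀ E L : Set Obs, MeasurableSet E → MeasurableSet L →
      RatioMixBound η S n a b w h E L :=
    ratioMix_of_masterMul ScreeningAssembly.screeningOffsetMul ScreeningAssembly.screening_master_mul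
  -- the far-conditioned RSW family at all aspect ratios: unconditional inputs + ratio mixing + finite energy
  have hFar : ∀ k : ℕ, ∃ c : ℝ, 0 < c ∧ ∀ (S : Set ℤ) (n : ℕ), 1 ≤ n → ∀ (a b : ℤ) (w h : ℕ),
      n ≤ w → w ≤ k * n → n ≤ h → h ≤ k * n → ∀ E : Set Obs, MeasurableSet E →
      FarRSWBound c S n a b w h E :=
    stub_FarRSWOfInputs (hGlue hR4) hMix
  -- Manolescu's transport (registered `CondRSWBound` hypothesis superseded by the far family)
  have hLin : (∃ C c : ℝ, 0 < c ∧ ∀ (S : Set ℤ) (i : ℤ), (i ∈ S ↔ i + 1 ∉ S) →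
        ∃ T : Obs → Rnd → Obs, IsExchangeKernel C c S i T) →
      (∃ c : ℝ, 0 < c ∧ ∀ (S : Set ℤ) (n : ℕ), 1 ≤ n → ∀ (a b : ℤ) (E : Set Obs), MeasurableSet E →
        CondRSWBound c S n a b E) →
      ∃ K₁ : ℂ ≃L[ℝ] ℂ, IsTransportCoupling K₁ :=
    fun hK _ => linearTransport_of_parts_far stripLaw hTransport couplingLift hK hFar hMix
  exact IKLinearTransport_of_stubs stub_DiagramExchange pinnedExchange_holds (condRSW_of_farRSW hFar) hLin
    stub_CouplingToLimits (crudeCardyTri_of stub_TriLawOfEmpty stub_CrudeCardySiteTri)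

end Summit.CriticalPhenomena.CardyFormulaZ2.Theorems.IKLinearTransport.PinnedDiagramExchange

end
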